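import Mathlib
import Summits.Ventures.HodgeRepro2.T5CyclotomicTwentyOneCensus

/-!
# THE COMPLETE CENSUS OF `F = ℚ(ζ₂₁)^{⟨σ₁₃⟩}` BY THE RESIDUE CLASS OF `p mod 21`, AND ITS INFINITUDE

Tier-5 support N2 / N3 / §G-N4.2 (seat p3, gen 81). Files 288–289 exhibit the non-cyclotomic sextic Galois CM field
`F = ℚ(ζ₂₁)^{⟨σ₁₃⟩}` and read its census at seven primes. This file gives the WHOLE table: for `p ∤ 21` the residue
degree `f(P/p)` of `F` depends only on `p mod 21`, through the order of `p · ⟨13⟩` in `(ℤ/21ℤ)ˣ / ⟨13⟩ ≅ ℤ/6`: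

| `p mod 21` | `1, 13` | `8, 20` | `4, 10, 16, 19` | `2, 5, 11, 17` |
|---|---|---|---|---|
| `f(P/p)` | `1` | `2` | `3` | `6` |
| primes of `F` above `p` | `6` | `3` | `2` | `1` |
| a place `v` of `F⁺` above `p` | splits in `F` | STAYS PRIME (`f(v/p) = 1`) | splits (`f(v/p) = 3`) | STAYS PRIME (`f(v/p) = 3`) |

* `table`: the function `p mod 21 ↦ f`; **`orderOf_mk_eq_table`**: `ord(p · ⟨13⟩) = table (p % 21)` (a `decide` over the
  twelve unit classes); **`inertiaDeg_eq_table`**, `ncard_primesOver_mul_table`;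
* **`exists_map_eq_iff_mod`**: the place `v` of `F⁺` under `P ∣ p` stays prime in `F` iff `p mod 21 ∈ {2, 5, 8, 11, 17, 20}`;
  `ncard_primesOver_eq_two_iff_mod`: two primes of `F` above `v` iff `p mod 21 ∈ {1, 4, 10, 13, 16, 19}`;
* Dirichlet (Mathlib's `Nat.infinite_setOf_prime_and_eq_mod`): **`infinite_setOf_prime_eq_mod`** — each of the twelve
  classes contains infinitely many primes; hence infinitely many `p` with every place of `F⁺` above `p` staying prime in
  `F` with `f(P/p) = 6` (`p ≡ 2`), with `f(P/p) = 2` (`p ≡ 20`), and infinitely many `p` splitting completely (`p ≡ 1`):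
  `exists_map_eq_of_eq_two_mod`, `exists_map_eq_of_eq_twenty_mod`, `inertiaDeg_eq_one_of_eq_one_mod`.

§8(d): uses an L-value-free non-vanishing device: NO.
-/

open NumberField IsCyclotomicExtension.Rat Ideal IsDedekindDomain IsDedekindDomain.HeightOneSpectrum
open Summit.Ventures.HodgeRepro2.T5CyclotomicSubfieldInertiaDeg
  Summit.Ventures.HodgeRepro2.T5CyclotomicSubfieldSexticCensus
  Summit.Ventures.HodgeRepro2.T5CyclotomicTwentyOneSextic
  Summit.Ventures.HodgeRepro2.T5CyclotomicTwentyOneCensus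

namespace Summit.Ventures.HodgeRepro2.T5CyclotomicTwentyOneTable

section Table

/-- **The residue-degree table of `F = ℚ(ζ₂₁)^{⟨σ₁₃⟩}`**: `f(P/p)` as a function of `p mod 21` (`1` on `{1, 13}`, `2` on
`{8, 20}`, `3` on `{4, 10, 16, 19}`, `6` on the other unit classes `{2, 5, 11, 17}`). -/
def table (r : ℕ) : ℕ :=
  if r = 1 ∨ r = 13 then 1
  else if r = 8 ∨ r = 20 then 2
  else if r = 4 ∨ r = 10 ∨ r = 16 ∨ r = 19 then 3
  else 6

/-- `p % 21` is prime to `21` iff `p` is. -/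
theorem coprime_mod_iff (p : ℕ) : (p % 21).Coprime 21 ↔ p.Coprime 21 := by
  show Nat.gcd (p % 21) 21 = 1 ↔ Nat.gcd p 21 = 1
  rw [← Nat.gcd_rec, Nat.gcd_comm 21 p]

/-- `ord(r · ⟨13⟩) = table r` for every unit class `r < 21`: twelve decidable checks. -/
theorem orderOf_mk_eq_table_of_lt (r : ℕ) (hr : r < 21) (hr' : r.Coprime 21) :
    orderOf (QuotientGroup.mk (ZMod.unitOfCoprime r hr') : (ZMod 21)ˣ ⧸ Subgroup.zpowers u13) =
      table r := by
  interval_cases r <;>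
    first
    | exact absurd hr' (by decide)
    | exact orderOf_mk_eq _ hr' _ (by decide) (by decide) (by decide)

/-- The unit `p mod 21` depends only on `p % 21`. -/
theorem unitOfCoprime_eq_mod (p : ℕ) (hp : p.Coprime 21) :
    ZMod.unitOfCoprime p hp =
      ZMod.unitOfCoprime (p % 21) ((coprime_mod_iff p).mpr hp) := by
  rw [Units.ext_iff, ZMod.coe_unitOfCoprime, ZMod.coe_unitOfCoprime, ZMod.natCast_mod]

/-- **`ord(p · ⟨13⟩) = table (p % 21)`** in `(ℤ/21ℤ)ˣ / ⟨13⟩` for every `p` prime to `21`. -/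
theorem orderOf_mk_eq_table (p : ℕ) (hp : p.Coprime 21) :
    orderOf (QuotientGroup.mk (ZMod.unitOfCoprime p hp) : (ZMod 21)ˣ ⧸ Subgroup.zpowers u13) =
      table (p % 21) := by
  rw [unitOfCoprime_eq_mod]
  exact orderOf_mk_eq_table_of_lt (p % 21) (Nat.mod_lt _ (by norm_num)) _

/-- `table r` is even exactly on `{2, 5, 8, 11, 17, 20}` (among the unit classes). -/
theorem even_table_iff : ∀ r ∈ Finset.range 21, r.Coprime 21 →
    (Even (table r) ↔ r ∈ ({2, 5, 8, 11, 17, 20} : Finset ℕ)) := by decide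

/-- `table r` is odd exactly on `{1, 4, 10, 13, 16, 19}` (among the unit classes). -/
theorem odd_table_iff : ∀ r ∈ Finset.range 21, r.Coprime 21 →
    (Odd (table r) ↔ r ∈ ({1, 4, 10, 13, 16, 19} : Finset ℕ)) := by decide

/-- `table r = 1` exactly on `{1, 13}`. -/
theorem table_eq_one_iff : ∀ r ∈ Finset.range 21, r.Coprime 21 →
    (table r = 1 ↔ r ∈ ({1, 13} : Finset ℕ)) := by decide

/-- `table` takes the values `1, 2, 3, 6` only. -/
theorem table_mem : ∀ r ∈ Finset.range 21, table r ∈ ({1, 2, 3, 6} : Finset ℕ) := by decide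

end Table

section Field

variable (L : Type*) [Field L] [NumberField L] [IsCyclotomicExtension {21} ℚ L]
variable (p : ℕ) [hp : Fact p.Prime] (hpm : p.Coprime 21)
  (P : Ideal (𝓞 (fixedField L))) [hP : P.IsPrime] [hPp : P.LiesOver (span {(p : ℤ)})]

include hpm hP hPp in
/-- **`f(P/p) = table (p % 21)`** for every prime `p ∤ 21` and every prime `P` of `F` above it. -/
theorem inertiaDeg_eq_table : P.inertiaDeg ℤ = table (p % 21) := by
  rw [inertiaDeg_eq L p hpm P, orderOf_mk_eq_table]

include hpm hP hPp in
/-- `#{𝔭 ∣ p} · table (p % 21) = 6`. -/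
theorem ncard_primesOver_mul_table :
    ((span {(p : ℤ)}).primesOver (𝓞 (fixedField L))).ncard * table (p % 21) = 6 := by
  rw [← orderOf_mk_eq_table p hpm]
  exact ncard_primesOver_mul_orderOf L p hpm P

variable (v : HeightOneSpectrum (𝓞 (maximalRealSubfield (fixedField L)))) [hPv : P.LiesOver v.asIdeal]

include hpm hP hPp hPv in
/-- **THE CENSUS OF `F` BY `p mod 21`**: the place `v` of `F⁺` under `P ∣ p` stays prime in `F` iff
`p mod 21 ∈ {2, 5, 8, 11, 17, 20}`. -/
theorem exists_map_eq_iff_mod :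
    (∃ w : HeightOneSpectrum (𝓞 (fixedField L)),
        Ideal.map (algebraMap (𝓞 (maximalRealSubfield (fixedField L))) (𝓞 (fixedField L))) v.asIdeal =
          w.asIdeal) ↔
      p % 21 ∈ ({2, 5, 8, 11, 17, 20} : Finset ℕ) := by
  rw [exists_map_eq_iff L p hpm P v, orderOf_mk_eq_table]
  exact even_table_iff (p % 21) (Finset.mem_range.mpr (Nat.mod_lt _ (by norm_num)))
    ((coprime_mod_iff p).mpr hpm)

include hpm hP hPp hPv in
/-- Two primes of `F` above `v` iff `p mod 21 ∈ {1, 4, 10, 13, 16, 19}`. -/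
theorem ncard_primesOver_eq_two_iff_mod :
    (v.asIdeal.primesOver (𝓞 (fixedField L))).ncard = 2 ↔
      p % 21 ∈ ({1, 4, 10, 13, 16, 19} : Finset ℕ) := by
  rw [ncard_primesOver_eq_two_iff L p hpm P v, orderOf_mk_eq_table]
  exact odd_table_iff (p % 21) (Finset.mem_range.mpr (Nat.mod_lt _ (by norm_num)))
    ((coprime_mod_iff p).mpr hpm)

include hpm hP hPp in
/-- `p` splits completely in `F` iff `p ≡ 1` or `p ≡ 13 mod 21`. -/
theorem inertiaDeg_eq_one_iff_mod : P.inertiaDeg ℤ = 1 ↔ p % 21 ∈ ({1, 13} : Finset ℕ) := by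
  rw [inertiaDeg_eq_table L p hpm P]
  exact table_eq_one_iff (p % 21) (Finset.mem_range.mpr (Nat.mod_lt _ (by norm_num)))
    ((coprime_mod_iff p).mpr hpm)

end Field

section Dirichlet

/-- **Dirichlet on `(ℤ/21ℤ)ˣ`**: every unit class mod `21` contains infinitely many primes (Mathlib's
`Nat.infinite_setOf_prime_and_eq_mod`). -/
theorem infinite_setOf_prime_eq_mod (r : ℕ) (hr : r.Coprime 21) :
    {p : ℕ | p.Prime ∧ p % 21 = r % 21}.Infinite := by
  have h := Nat.infinite_setOf_prime_and_eq_mod (q := 21) (ZMod.unitOfCoprime r hr).isUnit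
  refine h.mono ?_
  rintro p ⟨hp, hpr⟩
  refine ⟨hp, ?_⟩
  rw [ZMod.coe_unitOfCoprime] at hpr
  exact (ZMod.natCast_eq_natCast_iff' p r 21).mp hpr

variable (L : Type*) [Field L] [NumberField L] [IsCyclotomicExtension {21} ℚ L]

/-- **Every prime `p ≡ 2 mod 21` is INERT in `F`** (`f(P/p) = 6`; the place of `F⁺` under `P` stays prime) — there are
infinitely many such `p` (`infinite_setOf_prime_eq_mod 2`). -/
theorem exists_map_eq_of_eq_two_mod (p : ℕ) [hp : Fact p.Prime] (h2 : p % 21 = 2)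
    (P : Ideal (𝓞 (fixedField L))) [P.IsPrime] [P.LiesOver (span {(p : ℤ)})]
    (v : HeightOneSpectrum (𝓞 (maximalRealSubfield (fixedField L)))) [P.LiesOver v.asIdeal] :
    P.inertiaDeg ℤ = 6 ∧ ∃ w : HeightOneSpectrum (𝓞 (fixedField L)),
      Ideal.map (algebraMap (𝓞 (maximalRealSubfield (fixedField L))) (𝓞 (fixedField L))) v.asIdeal =
        w.asIdeal := by
  have hpm : p.Coprime 21 := by
    rw [← coprime_mod_iff, h2]
    decide
  refine ⟨?_, ?_⟩
  · rw [inertiaDeg_eq_table L p hpm P, h2]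
    decide
  · rw [exists_map_eq_iff_mod L p hpm P v, h2]
    decide

/-- **Every prime `p ≡ 20 ≡ −1 mod 21` has `f(P/p) = 2` in `F`** and the place of `F⁺` under `P` stays prime (a degree-one
inert place) — infinitely many such `p`. -/
theorem exists_map_eq_of_eq_twenty_mod (p : ℕ) [hp : Fact p.Prime] (h20 : p % 21 = 20)
    (P : Ideal (𝓞 (fixedField L))) [P.IsPrime] [P.LiesOver (span {(p : ℤ)})]
    (v : HeightOneSpectrum (𝓞 (maximalRealSubfield (fixedField L)))) [P.LiesOver v.asIdeal] :
    P.inertiaDeg ℤ = 2 ∧ ∃ w : HeightOneSpectrum (𝓞 (fixedField L)),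
      Ideal.map (algebraMap (𝓞 (maximalRealSubfield (fixedField L))) (𝓞 (fixedField L))) v.asIdeal =
        w.asIdeal := by
  have hpm : p.Coprime 21 := by
    rw [← coprime_mod_iff, h20]
    decide
  refine ⟨?_, ?_⟩
  · rw [inertiaDeg_eq_table L p hpm P, h20]
    decide
  · rw [exists_map_eq_iff_mod L p hpm P v, h20]
    decide

/-- **Every prime `p ≡ 1 mod 21` splits completely in `F`** (`f(P/p) = 1`; two primes of `F` above every place of `F⁺`
above `p`) — infinitely many such `p`. -/
theorem inertiaDeg_eq_one_of_eq_one_mod (p : ℕ) [hp : Fact p.Prime] (h1 : p % 21 = 1)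
    (P : Ideal (𝓞 (fixedField L))) [P.IsPrime] [P.LiesOver (span {(p : ℤ)})]
    (v : HeightOneSpectrum (𝓞 (maximalRealSubfield (fixedField L)))) [P.LiesOver v.asIdeal] :
    P.inertiaDeg ℤ = 1 ∧ (v.asIdeal.primesOver (𝓞 (fixedField L))).ncard = 2 := by
  have hpm : p.Coprime 21 := by
    rw [← coprime_mod_iff, h1]
    decide
  refine ⟨?_, ?_⟩
  · rw [inertiaDeg_eq_table L p hpm P, h1]
    decide
  · rw [ncard_primesOver_eq_two_iff_mod L p hpm P v, h1]
    decide

end Dirichlet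

end Summit.Ventures.HodgeRepro2.T5CyclotomicTwentyOneTable
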